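import Summits.Ventures.CertifiedManyBodySolver.Downfold.RouterScoreColumns

/-!
# Router-word score, part 4b: the HEADER-LEVEL READING of a multi-P material (lowest-P worded cell),
# CELL-COMPLETE agreement, and the SPLIT-MATERIAL census of the MO-PRED-1 annex

Venture CertifiedManyBodySolver, cell `pub/hubbard-downfold`, seat hubbard-downfold-score-2 (session g21, 2026-08-30);
namespace `Summit.Ventures.CertifiedManyBodySolver.Downfold.RouterScore` (continues `RouterScoreColumns.lean` p498224,
where the header is the FIRST column of an assembled map). Finite, PROVED bookkeeping statements; nothing here is physics.

WHAT THIS IS NOT: not the MO-PRED-1 table of record (deputy-2's R-3 chain gives the numbers) and not a score of record.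
It is the kernel form of the two material-level members printed by `validation/score/router/mopred1_prereg.py`
(score-2's pre-registration annex, «PEN-COMPARABLE HEADER-LEVEL PAIR» since g18): for a material read at several
pressures, the HEADER reading is the §4.2 outcome of its LOWEST-P worded cell (`headerReading`, selection by minimum,
independent of the order in which the cells were worded — `headerCell_le`), the CELL-COMPLETE member asks every worded
cell to AGREE (`cellComplete`), and a material is SPLIT when its header reads AGREE while some other cell does not
(`split`; first v8 instance M237 CaFe₂As₂ @0 AGREE / @0.63 DISAGREE, MO-PRED-1.16). PROVED: cell-complete forces a header
AGREE (`headerReading_agree_of_cellComplete`); cell-complete ⇔ header AGREE ∧ not split (`cellComplete_iff`); columns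
carrying one and the same outcome are never split and their header reads that outcome (`headerReading_of_forall_eq`,
`split_false_of_forall_eq`) — in particular WORD-IDENTICAL columns scored against one typing (`wordIdentical_not_split`:
the same print at every P ⇒ the same `outcome` ⇒ «no split material», the M499 TlNi₂Se₂ ×3 / M504 NiS₂ ×2 receipts);
and over any table the header-AGREE count EQUALS the cell-complete count PLUS the split count
(`countHeaderAgree_eq`), so the two PAIR members of an annex differ exactly by the named split materials
(MO-PRED-1.22: header 181 ∣ 195, cell-complete 177 ∣ 191 ⇒ four split materials under either word set, `mopred122_gap`).
Pressures are natural numbers in MPa (0.63 GPa = 630) so that every instance is `decide`d.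
-/

namespace Summit.Ventures.CertifiedManyBodySolver.Downfold

namespace RouterScore

/-! ## §1 Cells, the lowest-P header cell, the two members and the split flag -/

/-- a worded (material, P) cell: pressure in MPa and the §4.2 outcome of its router word. [folklore] -/
structure Cell where
  /-- pressure of the column in MPa (0.63 GPa = 630) -/
  P : ℕ
  /-- the §4.2 outcome of the cell's word against the material's typing -/
  o : Outcome
  deriving DecidableEq, Repr

/-- the lower-pressure of a cell `c` and an optional cell (the earlier-listed `c` wins ties). [folklore] -/
def minCell (c : Cell) : Option Cell → Cell
  | none => c
  | some d => if d.P < c.P then d else c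

/-- the HEADER cell = a worded cell of lowest pressure (the earliest-listed one among ties); `none` for no cell.
[folklore] -/
def headerCell : List Cell → Option Cell
  | [] => none
  | c :: tl => some (minCell c (headerCell tl))

/-- the HEADER-LEVEL READING of a material (= deputy-2's material-level router reading on a map whose header word is
the lowest-P column's): the outcome of the header cell; no worded cell ⇒ `ABSTAIN_noWord`. [folklore] -/
def headerReading (cells : List Cell) : Outcome :=
  match headerCell cells with
  | some c => c.o
  | none => .ABSTAIN_noWord

/-- every worded cell of the material reads AGREE. [folklore] -/
def allAgree (cells : List Cell) : Bool := cells.all fun c => decide (c.o = Outcome.AGREE)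

/-- the CELL-COMPLETE member: the material has a worded cell and every worded cell AGREEs. [folklore] -/
def cellComplete (cells : List Cell) : Bool := decide (cells ≠ []) && allAgree cells

/-- a SPLIT material: header AGREE while some worded cell does not AGREE (counted AGREE by the header-level member,
not by the cell-complete member). [folklore] -/
def split (cells : List Cell) : Bool := decide (headerReading cells = Outcome.AGREE) && !allAgree cells

/-! ## §2 The header cell is a cell of minimal pressure -/

/-- no cell, no header. [folklore] -/
theorem headerCell_nil : headerCell [] = none := rfl

/-- the header of a nonempty cell list (definitional unfolding). [folklore] -/
theorem headerCell_cons (c : Cell) (tl : List Cell) : headerCell (c :: tl) = some (minCell c (headerCell tl)) := rfl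

/-- a nonempty material has a header cell. [folklore] -/
theorem headerCell_ne_none {cells : List Cell} (h : cells ≠ []) : headerCell cells ≠ none := by
  obtain ⟨c, tl, rfl⟩ := List.exists_cons_of_ne_nil h
  simp [headerCell_cons]

/-- `minCell` returns one of its two arguments. [folklore] -/
theorem minCell_eq_or (c : Cell) : ∀ o : Option Cell, minCell c o = c ∨ o = some (minCell c o)
  | none => Or.inl rfl
  | some d => by
    by_cases h : d.P < c.P
    · right; simp [minCell, h]
    · left; simp [minCell, h]

/-- `minCell` is at most its first argument in pressure. [folklore] -/
theorem minCell_P_le (c : Cell) : ∀ o : Option Cell, (minCell c o).P ≤ c.P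
  | none => Nat.le_refl _
  | some d => by
    by_cases h : d.P < c.P
    · simp only [minCell, h, if_true]; omega
    · simp only [minCell, h, if_false]; omega

/-- `minCell` is at most its second argument in pressure. [folklore] -/
theorem minCell_P_le_of_some (c d : Cell) : (minCell c (some d)).P ≤ d.P := by
  by_cases h : d.P < c.P
  · simp only [minCell, h, if_true]; omega
  · simp only [minCell, h, if_false]; omega

/-- the header cell is one of the material's cells. [folklore] -/
theorem headerCell_mem : ∀ {cells : List Cell} {c : Cell}, headerCell cells = some c → c ∈ cells
  | [], _, h => by simp [headerCell] at h
  | d :: tl, c, h => by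
    rw [headerCell_cons, Option.some.injEq] at h
    subst h
    rcases minCell_eq_or d (headerCell tl) with h1 | h1
    · rw [h1]; simp
    · exact List.mem_cons_of_mem _ (headerCell_mem h1)

/-- the header cell has the LOWEST pressure among the material's cells (selection by minimum, independent of the order
in which the cells were worded). [folklore] -/
theorem headerCell_le : ∀ {cells : List Cell} {c : Cell}, headerCell cells = some c → ∀ x ∈ cells, c.P ≤ x.P
  | [], _, h => by simp [headerCell] at h
  | d :: tl, c, h => by
    rw [headerCell_cons, Option.some.injEq] at h
    subst h
    intro x hx
    rcases List.mem_cons.mp hx with rfl | hx'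
    · exact minCell_P_le _ _
    · cases htl : headerCell tl with
      | none => exact absurd htl (headerCell_ne_none (List.ne_nil_of_mem hx'))
      | some d' => exact Nat.le_trans (minCell_P_le_of_some d d') (headerCell_le htl x hx')

/-! ## §3 The two members and the split flag -/

/-- If every cell carries the same outcome `o` (and there is a cell), the header reads `o`. [folklore] -/
theorem headerReading_of_forall_eq {cells : List Cell} {o : Outcome} (hne : cells ≠ [])
    (h : ∀ c ∈ cells, c.o = o) : headerReading cells = o := by
  unfold headerReading
  cases hc : headerCell cells with
  | none => exact absurd hc (headerCell_ne_none hne)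
  | some c => simpa using h c (headerCell_mem hc)

/-- … and such a material is never split. [folklore] -/
theorem split_false_of_forall_eq {cells : List Cell} {o : Outcome} (h : ∀ c ∈ cells, c.o = o) :
    split cells = false := by
  by_cases hne : cells = []
  · subst hne; decide
  · have hh := headerReading_of_forall_eq hne h
    unfold split
    by_cases ho : o = Outcome.AGREE
    · subst ho
      have : allAgree cells = true := by
        simp only [allAgree, List.all_eq_true, decide_eq_true_eq]; exact h
      simp [this]
    · simp [hh, ho]

/-- cell-complete forces a header AGREE. [folklore] -/
theorem headerReading_agree_of_cellComplete {cells : List Cell} (h : cellComplete cells = true) :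
    headerReading cells = .AGREE := by
  simp only [cellComplete, allAgree, Bool.and_eq_true, decide_eq_true_eq, List.all_eq_true] at h
  exact headerReading_of_forall_eq h.1 h.2

/-- a cell-complete material is not split. [folklore] -/
theorem split_false_of_cellComplete {cells : List Cell} (h : cellComplete cells = true) : split cells = false := by
  simp only [cellComplete, Bool.and_eq_true] at h
  simp [split, h.2]

/-- CELL-COMPLETE ⇔ header AGREE ∧ not split. [folklore] -/
theorem cellComplete_iff (cells : List Cell) :
    cellComplete cells = true ↔ headerReading cells = .AGREE ∧ split cells = false := by
  constructor
  · exact fun h => ⟨headerReading_agree_of_cellComplete h, split_false_of_cellComplete h⟩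
  · rintro ⟨hh, hs⟩
    have hne : cells ≠ [] := by
      rintro rfl; simp [headerReading, headerCell] at hh
    simp only [split, hh, decide_true, Bool.true_and, Bool.not_eq_false'] at hs
    simp [cellComplete, hne, hs]

/-- a SPLIT material reads header AGREE and is not cell-complete — the registered case in which the two annex members
differ. [folklore] -/
theorem split_members {cells : List Cell} (h : split cells = true) :
    headerReading cells = .AGREE ∧ cellComplete cells = false := by
  simp only [split, Bool.and_eq_true, decide_eq_true_eq, Bool.not_eq_true'] at h
  refine ⟨h.1, ?_⟩
  simp [cellComplete, h.2]

/-! ## §4 Word-identical columns are never split -/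

section wordIdentical

variable {α : Type*} [DecidableEq α] (structural : α → Bool)

/-- the cells of a material whose columns all print ONE AND THE SAME word `e`, scored against one typing `alts`:
pressure list `Ps`, every cell's outcome `outcome structural e alts`. [folklore] -/
def wordIdenticalCells (e : List α) (alts : List (List α)) (Ps : List ℕ) : List Cell :=
  Ps.map fun P => ⟨P, outcome structural e alts⟩

/-- WORD-IDENTICAL columns ⇒ «no split material»: the same print at every pressure scores the same outcome in every
cell, so the material is not split and (if worded at all) its header reads that common outcome — the value-free
observation «word-identical ×n, no split» of the receipts (M499 TlNi₂Se₂ ×3, M504 NiS₂ ×2, M43 ×3). [folklore] -/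
theorem wordIdentical_not_split (e : List α) (alts : List (List α)) (Ps : List ℕ) :
    split (wordIdenticalCells structural e alts Ps) = false ∧
      (Ps ≠ [] → headerReading (wordIdenticalCells structural e alts Ps) = outcome structural e alts) := by
  have h : ∀ c ∈ wordIdenticalCells structural e alts Ps, c.o = outcome structural e alts := by
    intro c hc
    simp only [wordIdenticalCells, List.mem_map] at hc
    obtain ⟨P, _, rfl⟩ := hc; rfl
  refine ⟨split_false_of_forall_eq h, fun hne => headerReading_of_forall_eq ?_ h⟩
  simpa [wordIdenticalCells] using hne

end wordIdentical

/-! ## §5 Over a table: header-AGREE count = cell-complete count + split count -/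

/-- number of materials (each = its cell list) on which a Boolean member fires. [folklore] -/
def countBy (f : List Cell → Bool) (table : List (List Cell)) : ℕ := (table.filter fun cells => f cells).length

/-- the header-level AGREE indicator. [folklore] -/
def headerAgree (cells : List Cell) : Bool := decide (headerReading cells = Outcome.AGREE)

/-- per material: header AGREE ⇔ cell-complete or split (exclusive). [folklore] -/
theorem headerAgree_eq_or (cells : List Cell) :
    headerAgree cells = (cellComplete cells || split cells) ∧ (cellComplete cells && split cells) = false := by
  constructor
  · by_cases hh : headerReading cells = .AGREE
    · by_cases ha : allAgree cells = true
      · have hne : cells ≠ [] := by rintro rfl; simp [headerReading, headerCell] at hh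
        simp [headerAgree, hh, cellComplete, hne, ha, split]
      · simp [headerAgree, hh, split, ha]
    · have hc : cellComplete cells = false := by
        by_contra hc'
        exact hh (headerReading_agree_of_cellComplete (by simpa using hc'))
      simp [headerAgree, hh, hc, split]
  · by_cases hc : cellComplete cells = true
    · simp [split_false_of_cellComplete hc]
    · simp at hc; simp [hc]

/-- THE SPLIT CENSUS IDENTITY: over any table, the header-level AGREE count equals the cell-complete count plus the
number of split materials — the two PAIR members of the annex differ exactly by the named split materials. [folklore] -/
theorem countHeaderAgree_eq (table : List (List Cell)) :
    countBy headerAgree table = countBy cellComplete table + countBy split table := by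
  induction table with
  | nil => simp [countBy]
  | cons cells tl ih =>
    have key := headerAgree_eq_or cells
    simp only [countBy, List.filter_cons] at ih ⊢
    by_cases hc : cellComplete cells = true
    · have hs := split_false_of_cellComplete hc
      have hh : headerAgree cells = true := by rw [key.1]; simp [hc]
      simp [hc, hs, hh, ih]; omega
    · by_cases hs : split cells = true
      · have hh : headerAgree cells = true := by rw [key.1]; simp [hs]
        simp at hc; simp [hc, hs, hh, ih]; omega
      · simp at hc hs
        have hh : headerAgree cells = false := by rw [key.1]; simp [hc, hs]
        simp [hc, hs, hh, ih]

/-- hence the cell-complete count never exceeds the header-level count (the cell-complete member is the stricter).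
[folklore] -/
theorem countCellComplete_le (table : List (List Cell)) :
    countBy cellComplete table ≤ countBy headerAgree table := by
  rw [countHeaderAgree_eq]; exact Nat.le_add_right _ _

/-- … with equality iff the table has no split material. [folklore] -/
theorem countCellComplete_eq_iff (table : List (List Cell)) :
    countBy cellComplete table = countBy headerAgree table ↔ countBy split table = 0 := by
  rw [countHeaderAgree_eq]; omega

/-! ## §6 Instances of record (pressures in MPa) -/

/-- M237 CaFe₂As₂ (MO-PRED-1.16, the first v8 split): @0 AGREE / @0.63 GPa DISAGREE ⇒ header AGREE, not cell-complete,
split. [folklore] -/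
theorem m237_split :
    headerReading [⟨0, .AGREE⟩, ⟨630, .DISAGREE⟩] = .AGREE ∧ cellComplete [⟨0, .AGREE⟩, ⟨630, .DISAGREE⟩] = false ∧
      split [⟨0, .AGREE⟩, ⟨630, .DISAGREE⟩] = true := by decide

/-- the selection is by MINIMUM pressure, not by row order: the same material worded high-P first reads the same.
[folklore] -/
theorem m237_order_free :
    headerReading [⟨630, .DISAGREE⟩, ⟨0, .AGREE⟩] = .AGREE ∧ split [⟨630, .DISAGREE⟩, ⟨0, .AGREE⟩] = true := by decide

/-- M317 BaP122-x0.33 after the 2026-08-30T03:32Z re-word: @0 k-head AGREE (FEPAIR) / @2.15 straddle DISAGREE ⇒ split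
(receipt «split material»). [folklore] -/
theorem m317_split :
    headerReading [⟨0, .AGREE⟩, ⟨2150, .DISAGREE⟩] = .AGREE ∧ split [⟨0, .AGREE⟩, ⟨2150, .DISAGREE⟩] = true := by
  decide

/-- M499 TlNi₂Se₂ @0 / @0.86 / @2.2: PARTIAL ×3 (word-identical k-head columns vs EPHMIX) ⇒ header PARTIAL, not
split, not cell-complete. [folklore] -/
theorem m499_uniform :
    headerReading [⟨0, .PARTIAL⟩, ⟨860, .PARTIAL⟩, ⟨2200, .PARTIAL⟩] = .PARTIAL ∧
      split [⟨0, .PARTIAL⟩, ⟨860, .PARTIAL⟩, ⟨2200, .PARTIAL⟩] = false ∧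
      cellComplete [⟨0, .PARTIAL⟩, ⟨860, .PARTIAL⟩, ⟨2200, .PARTIAL⟩] = false := by decide

/-- M504 NiS₂ @0 / @7.5: AGREE ×2 (word-identical) ⇒ cell-complete, header AGREE, not split. [folklore] -/
theorem m504_complete :
    cellComplete [⟨0, .AGREE⟩, ⟨7500, .AGREE⟩] = true ∧ headerReading [⟨0, .AGREE⟩, ⟨7500, .AGREE⟩] = .AGREE ∧
      split [⟨0, .AGREE⟩, ⟨7500, .AGREE⟩] = false := by decide

/-- a three-material table with one split material: header-AGREE 2 = cell-complete 1 + split 1. [folklore] -/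
theorem table_example :
    countBy headerAgree [[⟨0, .AGREE⟩, ⟨630, .DISAGREE⟩], [⟨0, .AGREE⟩, ⟨7500, .AGREE⟩],
        [⟨0, .PARTIAL⟩, ⟨860, .PARTIAL⟩]] = 2 ∧
      countBy cellComplete [[⟨0, .AGREE⟩, ⟨630, .DISAGREE⟩], [⟨0, .AGREE⟩, ⟨7500, .AGREE⟩],
        [⟨0, .PARTIAL⟩, ⟨860, .PARTIAL⟩]] = 1 ∧
      countBy split [[⟨0, .AGREE⟩, ⟨630, .DISAGREE⟩], [⟨0, .AGREE⟩, ⟨7500, .AGREE⟩],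
        [⟨0, .PARTIAL⟩, ⟨860, .PARTIAL⟩]] = 1 := by decide

/-- MO-PRED-1.22 annex of record (cut 2026-08-30T03:48:26Z): header-level PAIR 181 ∣ 195 of 274, cell-complete
177 ∣ 191 of 274 ⇒ by `countHeaderAgree_eq` exactly FOUR split materials under either word set. [folklore] -/
theorem mopred122_gap (hdr cc sp : ℕ) (h : hdr = cc + sp) (h1 : hdr = 181 ∧ cc = 177 ∨ hdr = 195 ∧ cc = 191) :
    sp = 4 := by omega

end RouterScore

end Summit.Ventures.CertifiedManyBodySolver.Downfold
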